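import Literature.Probability.Percolation.HorizontalTransport
import Literature.Probability.Percolation.TrackExchangeGrowthRate
import HarnessLib

/-!
# Transport of horizontal crossings through the regular block (GM14 Proposition 6.4) — II:
# laws and the product bound

Grimmett–Manolescu, *Bond percolation on isoradial graphs* (PTRF 159 (2014) 273–327 =
arXiv:1204.0505), §6.2: "The family `(ω^k : k ≥ 0)` is a sequence of configurations on the
`G^k` with associated law denoted `P`. […] The marginal law of `ω^k` under `P` is `P_{G^k}`",
and Lemma 6.6: the `(Y^k_n)` are "independent Bernoulli random variables with common parameter
`η`", constructed "step by step […] by the independence of `(Y_n)` and `ω`".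

On top of `HorizontalTransport` (the pathwise process `traj`, heights `hgt`, designated detour
events `Yev`/`Yb`):

* **laws** — `BlockData.blockW_fst_eq_chain` (a block on configurations is the
  `RandomMapChain.chain` of its sweeps), `BlockData.map_blockCfg` (an active block transports
  `P_{weights k}` to `P_{weights (k+1)}`: `map_sweep` chained by `map_chain`),
  `HData.map_blockCfg`, and `HData.map_finalCfg`: under `P_{α,β̃} ⊗ noise` the configuration
  after `K` blocks has law `P_{weights K}` (GM14: "The marginal law of `ω^k` under `P` is
  `P_{G^k}`");
* **the rate bound** — `ExchangeData.detourWeight_le_rateBound`: the conditional probability of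
  the distinguished outcome is at most `rateBound ε` (GM14 (6.28)–(6.29), `η_k(n) ≤ η`);
* **the product bound** — `HData.measure_forall_Yfin_le`: for the process started from a fixed
  `(ω^0, γ^0)` and every finite set `T` of pairs `(k, n)`, the noise-probability that all the
  designated detour events `Y^k_n`, `(k, n) ∈ T`, occur is at most `η^{#T}`
  (`RandomMapChain.measure_forall_before_mem_le` with the per-block cylinder bound
  `piNoise_cylinder_le` and the section bound `piNoise_section_Ycond_le`): the hypothesis of the
  growth lemma `exists_measure_exists_lt_process_le`.

## References

* G. R. Grimmett, I. Manolescu, PTRF 159 (2014) 273–327, arXiv:1204.0505, §6.2 (the law `P`,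
  Lemma 6.6 and its proof, (6.28)–(6.29)).
-/

noncomputable section

namespace Literature.Probability.Percolation

open LatticeModels StarTriangle Real MeasureTheory GrowthProcess

namespace TrackExchange

attribute [local instance] walkMeasurableSpace discreteMeasurableSpace_walk

/-! ### Laws -/

namespace BlockData

variable (B : BlockData)

/-- The noise of one sweep of the block (the same measure as every `(B.D s).sweepNoise`). [folklore] -/
def ν : Measure B.Noise :=
  (volume : Measure unitInterval).prod (Measure.pi fun _ : Fin (2 * B.M) => (volume : Measure unitInterval))

/-- The sweep noise is a probability measure. [folklore] -/
instance : IsProbabilityMeasure B.ν := by unfold ν; infer_instance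

/-- **A block on configurations is the chain of its sweeps.** [cite: GrimmettManolescu2014Isoradial, §6.2 (6.8)] -/
theorem blockW_fst_eq_chain (v : Fin B.N → B.Noise) (x : ExchangeData.WState) :
    ∀ n : ℕ, (B.blockW (B.ext v) n x).1 =
      RandomMapChain.chain n (fun s : Fin n => fun ω r => (B.D s).sweep ω r) x.1 (fun s : Fin n => B.ext v s)
  | 0 => rfl
  | n + 1 => by
    rw [blockW_succ, ExchangeData.sweepW_fst, blockW_fst_eq_chain v x n, RandomMapChain.chain_succ_last]
    rfl

/-- **An active block transports `P_{initial}` to `P_{final}`** (GM14: `U_k` maps `P_{G^{k-1}}`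
to `P_{G^k}`; `map_sweep` chained by `map_chain`). [cite: GrimmettManolescu2014Isoradial, §6.2] -/
theorem map_blockCfg (hB : B.Valid) :
    ((prodBernoulli ((B.D 0).initial)).prod (Measure.pi fun _ : Fin B.N => B.ν)).map
        (fun x : Set (Sym2 SV) × (Fin B.N → B.Noise) => (B.blockW (B.ext x.2) B.N (x.1, [])).1) =
      prodBernoulli ((B.D B.N).initial) := by
  have hfun : (fun x : Set (Sym2 SV) × (Fin B.N → B.Noise) => (B.blockW (B.ext x.2) B.N (x.1, [])).1) =
      fun x => RandomMapChain.chain B.N (fun s : Fin B.N => fun ω r => (B.D s).sweep ω r) x.1 x.2 := by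
    funext x
    rw [blockW_fst_eq_chain]
    congr 1
    funext s
    exact B.ext_apply x.2 s
  rw [hfun]
  have h := RandomMapChain.map_chain B.ν B.N (fun s : Fin B.N => fun ω r => (B.D s).sweep ω r)
    (fun s => (B.D s).measurable_sweep) (fun s : Fin (B.N + 1) => prodBernoulli ((B.D s).initial)) fun s => ?_
  · simpa using h
  · have hs : (s : ℕ) < B.N := s.2
    have h1 := ExchangeData.map_sweep (B.D_valid hB hs)
    rw [B.D_exchanged_eq hB hs] at h1
    rw [Fin.val_castSucc]
    exact h1

end BlockData

namespace HData

variable (H : HData)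

/-- The noise measure of one sweep (definitionally every `(H.Bk k).ν`). [folklore] -/
def ν : Measure H.Noise :=
  (volume : Measure unitInterval).prod (Measure.pi fun _ : Fin (2 * H.M) => (volume : Measure unitInterval))

/-- The sweep noise is a probability measure. [folklore] -/
instance : IsProbabilityMeasure H.ν := by unfold ν; infer_instance

/-- The noise measure of one block: `N` independent sweep noises. [folklore] -/
def piNoise : Measure H.BNoise := Measure.pi fun _ : Fin H.N => H.ν

/-- The block noise is a probability measure. [folklore] -/
instance : IsProbabilityMeasure H.piNoise := by unfold piNoise; infer_instance

/-- **One block on configurations.** [cite: GrimmettManolescu2014Isoradial, §6.2] -/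
def blockCfg (k : ℕ) (ω : Set (Sym2 SV)) (v : H.BNoise) : Set (Sym2 SV) := (H.blockStep k (ω, []) v).1

/-- The configuration component of the block on pairs does not depend on the walk. [folklore] -/
theorem blockStep_fst (k : ℕ) (x : ExchangeData.WState) (v : H.BNoise) : (H.blockStep k x v).1 = H.blockCfg k x.1 v := by
  unfold blockCfg blockStep
  split_ifs
  · exact (H.Bk k).blockW_fst _ _ x
  · exact (H.Bk k).blockWRL_fst _ _ x
  · rfl

/-- The block on configurations is measurable. [folklore] -/
theorem measurable_blockCfg (k : ℕ) : Measurable (Function.uncurry (H.blockCfg k)) := by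
  have h : Function.uncurry (H.blockCfg k) =
      Prod.fst ∘ (fun x : ExchangeData.WState × H.BNoise => H.blockStep k x.1 x.2) ∘
        fun x : Set (Sym2 SV) × H.BNoise => ((x.1, ([] : List SV)), x.2) := rfl
  rw [h]
  exact measurable_fst.comp ((H.measurable_blockStep k).comp
    ((measurable_fst.prodMk measurable_const).prodMk measurable_snd))

/-- The weights after `k` blocks as canonical weights of the strip. [folklore] -/
theorem weights_eq (k : ℕ) : H.weights k = canonicalWeight H.M (fun i y => H.rowAngle k y - H.α i) := rfl

/-- The initial weights of the reflected `k`-th block. [folklore] -/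
theorem Bk_refl_initial (k : ℕ) :
    ((H.Bk k).refl.D 0).initial = canonicalWeight H.M (Θrefl fun i y => H.rowAngle k y - H.α i) := by
  rw [BlockData.refl_D_initial, Bk_rowβ_zero]; rfl

/-- The final weights of the reflected `k`-th block. [folklore] -/
theorem Bk_refl_final (k : ℕ) :
    ((H.Bk k).refl.D H.N).initial = canonicalWeight H.M (Θrefl fun i y => H.rowAngle (k + 1) y - H.α i) := by
  rw [show H.N = (H.Bk k).N from rfl, BlockData.refl_D_initial]
  show canonicalWeight H.M (Θrefl fun i y => (H.Bk k).rowβ H.N y - H.α i) = _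
  rw [Bk_rowβ_N]

/-- **One block transports `P_{weights k}` to `P_{weights (k+1)}`** (left to right:
`BlockData.map_blockCfg`; right to left: its conjugate by the reflection, `prodBernoulli_map_reflCfg`;
skipped: the weights coincide). [cite: GrimmettManolescu2014Isoradial, §6.2] -/
theorem map_blockCfg {ε : ℝ} (hH : H.Valid ε) (k : ℕ) :
    ((prodBernoulli (H.weights k)).prod H.piNoise).map (Function.uncurry (H.blockCfg k)) = prodBernoulli (H.weights (k + 1)) := by
  by_cases h1 : H.ξ < H.β k
  · have h : Function.uncurry (H.blockCfg k) =
        fun x : Set (Sym2 SV) × H.BNoise => ((H.Bk k).blockW ((H.Bk k).ext x.2) H.N (x.1, [])).1 := by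
      funext ⟨ω, v⟩; simp [blockCfg, blockStep, h1]
    rw [h, ← Bk_initial, ← Bk_final]
    exact (H.Bk k).map_blockCfg (Bk_valid hH h1)
  by_cases h2 : H.β k < H.ξ
  · -- conjugate by the reflection
    set F : Set (Sym2 SV) × H.BNoise → Set (Sym2 SV) :=
      fun y => ((H.Bk k).refl.blockW ((H.Bk k).refl.ext y.2) H.N (y.1, [])).1 with hF
    have hFm : Measurable F := by
      have := (H.Bk k).refl.measurable_blockW H.N
      exact measurable_fst.comp (measurable_uncurry_comp (f := fun (x : ExchangeData.WState) (v : Fin H.N → H.Noise) =>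
        (H.Bk k).refl.blockW ((H.Bk k).refl.ext v) H.N x) this (measurable_fst.prodMk measurable_const) measurable_snd)
    have h : Function.uncurry (H.blockCfg k) = reflCfg ∘ F ∘ Prod.map reflCfg id := by
      funext ⟨ω, v⟩
      simp only [Function.uncurry_apply_pair, blockCfg, blockStep, if_neg h1, if_pos h2, BlockData.blockWRL, reflW, hF,
        Function.comp_apply, Prod.map_apply, id_eq, List.map_nil]
      rfl
    rw [h, ← Measure.map_map measurable_reflCfg (hFm.comp (measurable_reflCfg.prodMap measurable_id)),
      ← Measure.map_map hFm (measurable_reflCfg.prodMap measurable_id),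
      ← Measure.map_prod_map _ _ measurable_reflCfg measurable_id, Measure.map_id, weights_eq,
      prodBernoulli_map_reflCfg, ← Bk_refl_initial]
    have hB := BlockData.refl_valid (Bk_validRL hH h2)
    have hblock : ((prodBernoulli ((H.Bk k).refl.D 0).initial).prod H.piNoise).map F =
        prodBernoulli ((H.Bk k).refl.D H.N).initial := (H.Bk k).refl.map_blockCfg hB
    rw [hblock, Bk_refl_final, prodBernoulli_map_reflCfg, Θrefl_Θrefl, ← weights_eq]
  · have heq : H.β k = H.ξ := le_antisymm (not_lt.1 h1) (not_lt.1 h2)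
    have h : Function.uncurry (H.blockCfg k) = Prod.fst := by
      funext ⟨ω, v⟩; simp [blockCfg, blockStep, h1, h2]
    rw [h, Measure.map_fst_prod, measure_univ, one_smul, H.weights_succ_of_eq heq]

/-- **The configuration after `K` blocks.** [cite: GrimmettManolescu2014Isoradial, §6.2] -/
def finalCfg (ω : Set (Sym2 SV)) (V : Fin H.K → H.BNoise) : Set (Sym2 SV) :=
  RandomMapChain.chain H.K (fun k : Fin H.K => H.blockCfg k) ω V

/-- The configuration after `K` blocks is jointly measurable. [folklore] -/
theorem measurable_finalCfg : Measurable (Function.uncurry H.finalCfg) :=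
  RandomMapChain.measurable_chain H.K _ fun k => H.measurable_blockCfg k

/-- **"The marginal law of `ω^k` under `P` is `P_{G^k}`"**: started from `P_{α,β̃}` (the weights
at time `0`) and fed independent noise, the configuration after `K` blocks has law
`P_{weights K}`. [cite: GrimmettManolescu2014Isoradial, §6.2] -/
theorem map_finalCfg {ε : ℝ} (hH : H.Valid ε) :
    ((prodBernoulli (H.weights 0)).prod (Measure.pi fun _ : Fin H.K => H.piNoise)).map (Function.uncurry H.finalCfg) =
      prodBernoulli (H.weights H.K) := by
  have hf : Function.uncurry H.finalCfg =
      fun x => RandomMapChain.chain H.K (fun k : Fin H.K => H.blockCfg k) x.1 x.2 := by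
    funext ⟨a, b⟩; rfl
  have h := RandomMapChain.map_chain H.piNoise H.K (fun k : Fin H.K => H.blockCfg k) (fun k => H.measurable_blockCfg k)
    (fun k : Fin (H.K + 1) => prodBernoulli (H.weights k)) fun k => ?_
  · rw [hf]; simpa using h
  · rw [Fin.val_castSucc, Fin.val_succ]
    exact H.map_blockCfg hH k

/-! ### From finite noise sequences to the trajectory -/

/-- Extension of a finite sequence of block noises. [folklore] -/
def extK (V : Fin H.K → H.BNoise) (k : ℕ) : H.BNoise := if h : k < H.K then V ⟨k, h⟩ else fun _ => (0, fun _ => 0)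

/-- `extK` on the range. [folklore] -/
theorem extK_apply (V : Fin H.K → H.BNoise) (k : Fin H.K) : H.extK V k = V k := by
  unfold extK; rw [dif_pos k.2]

/-- Each coordinate of `extK` is measurable. [folklore] -/
theorem measurable_extK (k : ℕ) : Measurable fun V : Fin H.K → H.BNoise => H.extK V k := by
  unfold extK; split_ifs
  · exact measurable_pi_apply _
  · exact measurable_const

/-- **The states before each block are the trajectory.** [folklore] -/
theorem before_eq_traj (x₀ : ExchangeData.WState) (V : Fin H.K → H.BNoise) (k : Fin H.K) :
    RandomMapChain.before H.K (fun k : Fin H.K => H.blockStep k) x₀ V k = H.traj x₀ (H.extK V) k := by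
  -- both are the `k`-fold iteration of `blockStep` along `V`
  suffices h : ∀ (m : ℕ) (hm : m ≤ H.K),
      RandomMapChain.chain m (fun i : Fin m => H.blockStep i) x₀ (fun i : Fin m => H.extK V i) = H.traj x₀ (H.extK V) m by
    unfold RandomMapChain.before
    have h' := h k.1 k.2.le
    rw [← h']
    congr 1
    funext i
    exact (H.extK_apply V (i.castLE k.2.le)).symm
  intro m
  induction m with
  | zero => intro; rfl
  | succ m ih =>
    intro hm
    rw [RandomMapChain.chain_succ_last, traj_succ, ← ih (by omega)]
    rfl

/-- **The final state of the chain is the trajectory at time `K`.** [folklore] -/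
theorem chain_eq_traj (x₀ : ExchangeData.WState) (V : Fin H.K → H.BNoise) :
    RandomMapChain.chain H.K (fun k : Fin H.K => H.blockStep k) x₀ V = H.traj x₀ (H.extK V) H.K := by
  suffices h : ∀ (m : ℕ) (hm : m ≤ H.K),
      RandomMapChain.chain m (fun i : Fin m => H.blockStep i) x₀ (fun i : Fin m => H.extK V i) = H.traj x₀ (H.extK V) m by
    have h' := h H.K le_rfl
    rw [← h']
    congr 1
    funext i
    exact (H.extK_apply V i).symm
  intro m
  induction m with
  | zero => intro; rfl
  | succ m ih =>
    intro hm
    rw [RandomMapChain.chain_succ_last, traj_succ, ← ih (by omega)]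
    rfl

/-- The configuration of the trajectory is the chain of blocks on configurations. [folklore] -/
theorem traj_fst (x₀ : ExchangeData.WState) (V : Fin H.K → H.BNoise) :
    (H.traj x₀ (H.extK V) H.K).1 = H.finalCfg x₀.1 V := by
  rw [← chain_eq_traj]
  unfold finalCfg
  suffices h : ∀ (m : ℕ) (f : Fin m → ExchangeData.WState → H.BNoise → ExchangeData.WState)
      (g : Fin m → Set (Sym2 SV) → H.BNoise → Set (Sym2 SV)), (∀ k x u, (f k x u).1 = g k x.1 u) →
      ∀ (x : ExchangeData.WState) (u : Fin m → H.BNoise),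
        (RandomMapChain.chain m f x u).1 = RandomMapChain.chain m g x.1 u from
    h H.K _ _ (fun k x u => H.blockStep_fst k x u) x₀ V
  intro m
  induction m with
  | zero => intro f g _ x u; rfl
  | succ m ih =>
    intro f g hfg x u
    rw [RandomMapChain.chain_succ, RandomMapChain.chain_succ, ih _ _ (fun k => hfg k.succ), hfg]

/-- The trajectory is jointly measurable in the finite noise (for a fixed start). [folklore] -/
theorem measurable_traj (x₀ : ExchangeData.WState) (k : ℕ) (hk : k ≤ H.K) :
    Measurable fun V : Fin H.K → H.BNoise => H.traj x₀ (H.extK V) k := by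
  induction k with
  | zero => exact measurable_const
  | succ k ih =>
    simp only [traj_succ]
    exact measurable_uncurry_comp (H.measurable_blockStep k) (ih (by omega)) (H.measurable_extK k)

/-! ### The rate bound -/

end HData

namespace ExchangeData

variable {D : ExchangeData}

/-- The odds of `p_{π-θ}` are `p_{π-θ}/p_θ = criticalWeight(θ/2) / criticalWeight((π-θ)/2)`. [folklore] -/
theorem odds_angleWeight_pi_sub {θ : ℝ} (hθ : θ ∈ Set.Ioo 0 π) :
    (angleWeight (π - θ) : ℝ) / (1 - angleWeight (π - θ)) = criticalWeight (θ / 2) / criticalWeight ((π - θ) / 2) := by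
  have h1 : (1 : ℝ) - angleWeight (π - θ) = angleWeight θ := by
    linarith [coe_angleWeight_add_coe_angleWeight_pi_sub hθ]
  rw [h1]
  unfold angleWeight
  rw [coe_criticalWeightI_holds ⟨by linarith [hθ.1, hθ.2], by linarith [hθ.1, hθ.2]⟩,
    coe_criticalWeightI_holds ⟨by linarith [hθ.1, hθ.2], by linarith [hθ.1, hθ.2]⟩, sub_sub_cancel]

/-- **The conditional probability of the distinguished outcome is at most `η(ε)`** (GM14
(6.28)–(6.29): `η_k(n) = p_{π-A}p_{π-B}/(p_A p_B) = g(A, B) ≤ η < 1` with `A = ξ - α_n`,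
`B = β_k - ξ`, under `ε ≤ A ≤ A + B ≤ π - ε`). [cite: GrimmettManolescu2014Isoradial, §6.2 (6.28)–(6.29)] -/
theorem detourWeight_le_rateBound (hV : D.Valid) {ε : ℝ} (hε : 0 < ε) {c : ℤ} (hc : -(D.M : ℤ) ≤ c) (hc' : c < D.M)
    (hpar : Even (c + D.j)) (hA : ε ≤ D.lo - D.α c) (hAB : D.up - D.α c ≤ π - ε) :
    D.detourWeight c ≤ rateBound ε := by
  set A := D.lo - D.α c with hA_def
  set B := D.up - D.lo with hB_def
  have hB0 : 0 < B := hV.lu.1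
  have hAo : A ∈ Set.Ioo 0 π := hV.lo c hc hc'
  have hBo : B ∈ Set.Ioo 0 π := hV.lu
  have h0 : (D.oddStage (c + 1) (triEdge (D.evenTri c) 0) : ℝ) = angleWeight (π - B) :=
    congrArg Subtype.val (oddStage_succ_triEdge_zero hc hc')
  have h1 : (D.oddStage (c + 1) (triEdge (D.evenTri c) 1) : ℝ) = angleWeight (π - A) :=
    congrArg Subtype.val (oddStage_succ_triEdge_one hpar hc hc')
  have h2 : (D.oddStage (c + 1) (triEdge (D.evenTri c) 2) : ℝ) < 1 :=
    oddStage_succ_triEdge_lt_one hpar hc hc' hV.lu (hV.lo c hc hc') (hV.up c hc hc') 2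
  unfold detourWeight
  rw [sWeight_full_ttf h2]
  simp only [odds, triParam]
  rw [h0, h1, odds_angleWeight_pi_sub hBo, odds_angleWeight_pi_sub hAo]
  have hpA : 0 < criticalWeight ((π - A) / 2) := by
    have := coe_angleWeight_pos hAo
    unfold angleWeight at this
    rwa [coe_criticalWeightI_holds ⟨by linarith [hAo.1], by linarith [hAo.2]⟩] at this
  have hpB : 0 < criticalWeight ((π - B) / 2) := by
    have := coe_angleWeight_pos hBo
    unfold angleWeight at this
    rwa [coe_criticalWeightI_holds ⟨by linarith [hBo.1], by linarith [hBo.2]⟩] at this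
  rw [div_mul_div_comm, div_le_iff₀ (mul_pos hpB hpA), mul_comm (criticalWeight (B / 2))]
  calc criticalWeight (A / 2) * criticalWeight (B / 2)
      ≤ rateBound ε * (criticalWeight ((π - A) / 2) * criticalWeight ((π - B) / 2)) :=
        criticalWeight_mul_le_rateBound_mul hε hA hB0.le (by rw [hA_def, hB_def] at *; linarith)
    _ = rateBound ε * (criticalWeight ((π - B) / 2) * criticalWeight ((π - A) / 2)) := by ring

end ExchangeData

namespace HData

variable (H : HData)

/-! ### Cylinder sets of the block noise -/

/-- **A cylinder bound**: constraining, for each `n` in a finite set `J`, one coordinate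
`(v (s n)).2 (t n)` of the block noise to lie below `η ∈ [0, 1]`, with `t` injective on `J`,
has probability `η^{#J}`. [folklore] -/
theorem piNoise_cylinder_le (J : Finset ℤ) (s : ℤ → Fin H.N) (t : ℤ → Fin (2 * H.M)) (ht : Set.InjOn t J)
    {η : ℝ} (hη0 : 0 ≤ η) (hη1 : η ≤ 1) :
    H.piNoise {v | ∀ n ∈ J, ((v (s n)).2 (t n) : ℝ) < η} ≤ ENNReal.ofReal η ^ J.card := by
  classical
  -- as a product set
  set img : Finset (Fin H.N × Fin (2 * H.M)) := J.image fun n => (s n, t n) with himg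
  have hcard : img.card = J.card := Finset.card_image_of_injOn fun a ha b hb hab => ht ha hb (congrArg Prod.snd hab)
  set E : Fin H.N → Fin (2 * H.M) → Set unitInterval := fun i τ => if (i, τ) ∈ img then {u | (u : ℝ) < η} else Set.univ with hE
  have hsub : {v : H.BNoise | ∀ n ∈ J, ((v (s n)).2 (t n) : ℝ) < η} ⊆
      Set.pi Set.univ fun i => Prod.snd ⁻¹' Set.pi Set.univ (E i) := by
    intro v hv i _ τ _
    simp only [hE]
    split_ifs with hmem
    · rw [himg, Finset.mem_image] at hmem
      obtain ⟨n, hn, hst⟩ := hmem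
      simp only [Prod.mk.injEq] at hst
      rw [← hst.1, ← hst.2]
      exact hv n hn
    · trivial
  refine (measure_mono hsub).trans ?_
  unfold piNoise
  rw [Measure.pi_pi]
  have hi : ∀ i, H.ν (Prod.snd ⁻¹' Set.pi Set.univ (E i)) = ∏ τ, (if (i, τ) ∈ img then ENNReal.ofReal η else 1) := by
    intro i
    unfold ν
    rw [← Set.univ_prod, Measure.prod_prod, measure_univ, one_mul, Measure.pi_pi]
    refine Finset.prod_congr rfl fun τ _ => ?_
    simp only [hE]
    split_ifs
    · have := volume_setOf_coe_lt ⟨η, hη0, hη1⟩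
      exact le_antisymm (by rw [this]) (by rw [this])
    · exact measure_univ
  simp_rw [hi]
  rw [← Finset.prod_product' (f := fun i τ => if (i, τ) ∈ img then ENNReal.ofReal η else 1), Finset.univ_product_univ,
    Finset.prod_ite_mem, Finset.univ_inter, Finset.prod_const, hcard]

/-! ### The product bound for the designated detour events -/

/-- **The per-block detour condition** as a predicate on (state before the block, block noise):
block `k` is active and the designated detour event of the shifted column `n + d_k` occurs (for a
right-to-left block, that of the reflected block at the reflected column).
[cite: GrimmettManolescu2014Isoradial, §6.2 Lemma 6.6] -/
def Ycond (k : ℕ) (x : ExchangeData.WState) (v : H.BNoise) (n : ℤ) : Prop :=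
  (H.ξ < H.β k ∧ (H.Bk k).Ydet x.2 ((H.Bk k).ext v) (n + H.shift k)) ∨
  (H.β k < H.ξ ∧ (H.Bk k).refl.Ydet (x.2.map reflL) ((H.Bk k).ext v) (-(n + H.shift k)))

/-- The indicators fed to the growth process, for a finite noise sequence: `Y^k_n` for `k < K`,
`false` beyond. [cite: GrimmettManolescu2014Isoradial, §6.2] -/
def Yfin (x₀ : ExchangeData.WState) (V : Fin H.K → H.BNoise) (k : ℕ) (n : ℤ) : Bool :=
  if k < H.K then H.Yb x₀ (H.extK V) k n else false

/-- `Y^k_n = 1` in terms of the state before block `k` and the noise of block `k`. [folklore] -/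
theorem Yb_extK_eq_true_iff (x₀ : ExchangeData.WState) (V : Fin H.K → H.BNoise) (k : Fin H.K) (n : ℤ) :
    H.Yb x₀ (H.extK V) k n = true ↔ H.Ycond k (H.traj x₀ (H.extK V) k) (V k) n := by
  have h : H.Ycond k (H.traj x₀ (H.extK V) k) (V k) n ↔ H.Yev x₀ (H.extK V) k n := by
    unfold Ycond Yev; rw [H.extK_apply V k]
  rw [h]
  classical
  unfold Yb
  simp only [decide_eq_true_eq]

/-- The detour condition of a left-to-right block is a measurable subset of (state, block noise). [folklore] -/
theorem measurableSet_detourCondL (k : ℕ) (P : Prop) (c : ℤ) :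
    MeasurableSet {p : ExchangeData.WState × H.BNoise | P ∧ (H.Bk k).Ydet (p.1.2) ((H.Bk k).ext p.2) c} := by
  have h : {p : ExchangeData.WState × H.BNoise | P ∧ (H.Bk k).Ydet (p.1.2) ((H.Bk k).ext p.2) c} =
      ⋃ s : ℕ, ⋃ t : Fin (2 * H.M),
      ((fun p : ExchangeData.WState × H.BNoise => p.1.2) ⁻¹'
          {W | P ∧ s < H.N ∧ Even (c + (H.Bk k).level s) ∧ ((H.Bk k).level s : WithBot ℤ) = colmax (W) c ∧
            -(H.M : ℤ) + t = c}) ∩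
        {p | (((H.Bk k).ext p.2 s).2 t : ℝ) < ((H.Bk k).D s).detourWeight c} := by
    ext p
    simp only [Set.mem_setOf_eq, BlockData.Ydet, ExchangeData.DetourAt, Set.mem_iUnion, Set.mem_inter_iff,
      Set.mem_preimage]
    constructor
    · rintro ⟨h1, s, h2, h3, h4, t, h5, h6⟩
      exact ⟨s, t, ⟨h1, h2, h3, h4, h5⟩, h6⟩
    · rintro ⟨s, t, ⟨h1, h2, h3, h4, h5⟩, h6⟩
      exact ⟨h1, s, h2, h3, h4, t, h5, h6⟩
  rw [h]
  refine MeasurableSet.iUnion fun s => MeasurableSet.iUnion fun t => MeasurableSet.inter ?_ ?_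
  · exact (measurable_snd.comp measurable_fst) MeasurableSet.of_discrete
  · refine measurableSet_lt ?_ measurable_const
    exact measurable_subtype_coe.comp ((measurable_pi_apply t).comp (measurable_snd.comp
      (((H.Bk k).measurable_ext s).comp measurable_snd)))

/-- The detour condition of a right-to-left block is a measurable subset of (state, block noise). [folklore] -/
theorem measurableSet_detourCondR (k : ℕ) (P : Prop) (c : ℤ) :
    MeasurableSet {p : ExchangeData.WState × H.BNoise | P ∧ (H.Bk k).refl.Ydet (p.1.2.map reflL) ((H.Bk k).ext p.2) c} := by
  have h : {p : ExchangeData.WState × H.BNoise | P ∧ (H.Bk k).refl.Ydet (p.1.2.map reflL) ((H.Bk k).ext p.2) c} =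
      ⋃ s : ℕ, ⋃ t : Fin (2 * H.M),
      ((fun p : ExchangeData.WState × H.BNoise => p.1.2) ⁻¹'
          {W | P ∧ s < H.N ∧ Even (c + (H.Bk k).refl.level s) ∧ ((H.Bk k).refl.level s : WithBot ℤ) = colmax (W.map reflL) c ∧
            -(H.M : ℤ) + t = c}) ∩
        {p | (((H.Bk k).ext p.2 s).2 t : ℝ) < ((H.Bk k).refl.D s).detourWeight c} := by
    ext p
    simp only [Set.mem_setOf_eq, BlockData.Ydet, ExchangeData.DetourAt, Set.mem_iUnion, Set.mem_inter_iff,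
      Set.mem_preimage]
    constructor
    · rintro ⟨h1, s, h2, h3, h4, t, h5, h6⟩
      exact ⟨s, t, ⟨h1, h2, h3, h4, h5⟩, h6⟩
    · rintro ⟨s, t, ⟨h1, h2, h3, h4, h5⟩, h6⟩
      exact ⟨h1, s, h2, h3, h4, t, h5, h6⟩
  rw [h]
  refine MeasurableSet.iUnion fun s => MeasurableSet.iUnion fun t => MeasurableSet.inter ?_ ?_
  · exact (measurable_snd.comp measurable_fst) MeasurableSet.of_discrete
  · refine measurableSet_lt ?_ measurable_const
    exact measurable_subtype_coe.comp ((measurable_pi_apply t).comp (measurable_snd.comp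
      (((H.Bk k).measurable_ext s).comp measurable_snd)))

/-- The detour condition is a measurable subset of (state, block noise). [folklore] -/
theorem measurableSet_Ycond (k : ℕ) (n : ℤ) :
    MeasurableSet {p : ExchangeData.WState × H.BNoise | H.Ycond k p.1 p.2 n} :=
  (H.measurableSet_detourCondL k _ _).union (H.measurableSet_detourCondR k _ _)

/-- The levels of a block are pairwise distinct. [folklore] -/
theorem Bk_level_injective (k : ℕ) {a b : ℕ} (h : (H.Bk k).level a = (H.Bk k).level b) : a = b := by
  rw [Bk_level, Bk_level] at h; omega

variable {H}

/-- **The section bound**: whatever the state before block `k`, the noise of block `k` makes all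
the designated detour events of the columns `n`, `(k, n) ∈ T`, occur with probability at most
`η^{#T_k}` — they constrain distinct coordinates of the noise, each with probability `≤ η`
(`detourWeight_le_rateBound`). [cite: GrimmettManolescu2014Isoradial, §6.2 Lemma 6.6] -/
theorem piNoise_section_Ycond_le {ε : ℝ} (hH : H.Valid ε) (T : Finset (ℕ × ℤ)) (k : ℕ) (x : ExchangeData.WState) :
    H.piNoise {v | ∀ n : ℤ, (k, n) ∈ T → H.Ycond k x v n} ≤
      ENNReal.ofReal (rateBound ε) ^ (T.filter fun i => i.1 = k).card := by
  classical
  set η := rateBound ε with hη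
  have hη0 : 0 ≤ η := (rateBound_pos hH.ε_pos.le hH.ε_le).le
  have hη1 : η ≤ 1 := (rateBound_lt_one hH.ε_pos hH.ε_le).le
  set Tk := T.filter fun i => i.1 = k with hTk
  set J : Finset ℤ := Tk.image Prod.snd with hJ
  have hJcard : J.card = Tk.card := by
    refine Finset.card_image_of_injOn fun a ha b hb hab => ?_
    rw [Finset.mem_coe, hTk, Finset.mem_filter] at ha hb
    exact Prod.ext (ha.2.trans hb.2.symm) hab
  have hJmem : ∀ n, (k, n) ∈ T ↔ n ∈ J := by
    intro n
    rw [hJ, Finset.mem_image]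
    constructor
    · intro h; exact ⟨(k, n), by rw [hTk, Finset.mem_filter]; exact ⟨h, rfl⟩, rfl⟩
    · rintro ⟨⟨k', n'⟩, h1, h2⟩
      rw [hTk, Finset.mem_filter] at h1
      simp only at h2 h1; rw [← h2, ← h1.2]; exact h1.1
  rw [← hJcard]
  -- the empty cases
  have hempty : ∀ {S : Set H.BNoise}, S = ∅ → H.piNoise S ≤ ENNReal.ofReal η ^ J.card := by
    rintro S rfl; simp
  by_cases hJ0 : J = ∅
  · rw [hJ0, Finset.card_empty, pow_zero]; exact prob_le_one
  obtain ⟨n₀, hn₀⟩ := Finset.nonempty_iff_ne_empty.2 hJ0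
  have hMpos : 0 < 2 * H.M := by have := hH.M_pos; omega
  -- the generic cylinder argument: walk read-off `g`, columns `cc`, levels `lev`, detour weights `dw`
  have key : ∀ (g : List SV → List SV) (cc : ℤ → ℤ) (lev : ℕ → ℤ) (dw : ℕ → ℤ → ℝ),
      Set.InjOn cc J → (∀ a b : ℕ, lev a = lev b → a = b) →
      (∀ s : ℕ, s < H.N → ∀ c : ℤ, -(H.M : ℤ) ≤ c → c < H.M → Even (c + lev s) → dw s c ≤ η) →
      (∀ v n, n ∈ J → H.Ycond k x v n → ∃ s : ℕ, s < H.N ∧ Even (cc n + lev s) ∧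
          (lev s : WithBot ℤ) = colmax (g x.2) (cc n) ∧
          ∃ t : Fin (2 * H.M), -(H.M : ℤ) + t = cc n ∧ (((H.Bk k).ext v s).2 t : ℝ) < dw s (cc n)) →
      H.piNoise {v | ∀ n : ℤ, (k, n) ∈ T → H.Ycond k x v n} ≤ ENNReal.ofReal η ^ J.card := by
    intro g cc lev dw hcc hlinj hrate hY
    by_cases hrange : ∀ n ∈ J, 0 ≤ cc n + H.M ∧ cc n + H.M < 2 * H.M
    swap
    · push Not at hrange
      obtain ⟨n, hn, hbad⟩ := hrange
      refine hempty (Set.eq_empty_of_forall_notMem fun v hv => ?_)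
      obtain ⟨s, -, -, -, t, ht, -⟩ := hY v n hn (hv n ((hJmem n).2 hn))
      have h1 : (t : ℕ) < 2 * H.M := t.2
      exact absurd (hbad (by omega)) (by omega)
    set tt : ℤ → Fin (2 * H.M) := fun n =>
      if h : 0 ≤ cc n + H.M ∧ cc n + H.M < 2 * H.M then ⟨(cc n + H.M).toNat, by omega⟩ else ⟨0, hMpos⟩ with htt
    set ss : ℤ → Fin H.N := fun n =>
      if h : ∃ s : Fin H.N, (lev s : WithBot ℤ) = colmax (g x.2) (cc n) then h.choose else ⟨0, hH.N_pos⟩ with hss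
    have htt_inj : Set.InjOn tt J := by
      intro a ha b hb hab
      have ha' := hrange a ha; have hb' := hrange b hb
      simp only [htt, dif_pos ha', dif_pos hb', Fin.mk.injEq] at hab
      exact hcc ha hb (by omega)
    refine (measure_mono fun v hv => ?_).trans (H.piNoise_cylinder_le J ss tt htt_inj hη0 hη1)
    intro n hn
    obtain ⟨s, hs, hpar, hlev, t, ht, hlt⟩ := hY v n hn (hv n ((hJmem n).2 hn))
    have ht1 : (t : ℕ) < 2 * H.M := t.2
    have hss' : ss n = ⟨s, hs⟩ := by
      have hex : ∃ s' : Fin H.N, (lev s' : WithBot ℤ) = colmax (g x.2) (cc n) := ⟨⟨s, hs⟩, hlev⟩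
      simp only [hss, dif_pos hex]
      apply Fin.ext
      have h1 : (lev (hex.choose : ℕ) : WithBot ℤ) = colmax (g x.2) (cc n) := hex.choose_spec
      exact hlinj _ _ (by exact_mod_cast h1.trans hlev.symm)
    have hrn := hrange n hn
    have htt' : tt n = ⟨t.1, ht1⟩ := by
      simp only [htt, dif_pos hrn]
      apply Fin.ext
      simp only
      omega
    rw [hss', htt']
    have hext : (H.Bk k).ext v s = v ⟨s, hs⟩ := (H.Bk k).ext_apply v ⟨s, hs⟩
    rw [hext] at hlt
    exact lt_of_lt_of_le hlt (hrate s hs (cc n) (by omega) (by omega) hpar)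
  have hlinj : ∀ a b : ℕ, (H.Bk k).level a = (H.Bk k).level b → a = b := fun a b h => H.Bk_level_injective k h
  by_cases h1 : H.ξ < H.β k
  · have hB := Bk_valid hH h1
    refine key id (fun n => n + H.shift k) (H.Bk k).level (fun s c => ((H.Bk k).D s).detourWeight c)
      (fun a _ b _ hab => by simpa using hab) hlinj (fun s hs c hc hc' hpar => ?_) (fun v n _ hYc => ?_)
    · have hV := (H.Bk k).D_valid hB hs
      have hlo : ((H.Bk k).D s).lo = H.ξ := (H.Bk k).D_lo hB hs
      have hup : ((H.Bk k).D s).up = H.β k := (H.Bk k).D_up s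
      refine ExchangeData.detourWeight_le_rateBound hV hH.ε_pos hc hc' hpar ?_ ?_
      · rw [hlo]; exact (hH.ξα c hc hc').1
      · rw [hup]; exact (hH.βα k c hc hc').2
    · rcases hYc with ⟨-, s, hs, hpar, hlev, t, ht, hlt⟩ | ⟨h2, -⟩
      · exact ⟨s, hs, hpar, hlev, t, ht, hlt⟩
      · exact absurd h1 (lt_asymm h2)
  by_cases h2 : H.β k < H.ξ
  · have hB := BlockData.refl_valid (Bk_validRL hH h2)
    refine key (fun W => W.map reflL) (fun n => -(n + H.shift k)) (H.Bk k).refl.level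
      (fun s c => ((H.Bk k).refl.D s).detourWeight c)
      (fun a _ b _ hab => by have : -(a + H.shift k) = -(b + H.shift k) := hab; omega) hlinj
      (fun s hs c hc hc' hpar => ?_) (fun v n _ hYc => ?_)
    · have hV := (H.Bk k).refl.D_valid hB hs
      have hlo : ((H.Bk k).refl.D s).lo = π - H.ξ := (H.Bk k).refl.D_lo hB hs
      have hup : ((H.Bk k).refl.D s).up = π - H.β k := (H.Bk k).refl.D_up s
      have hc1 : -(H.M : ℤ) ≤ -1 - c := by omega
      have hc2 : -1 - c < H.M := by omega
      refine ExchangeData.detourWeight_le_rateBound hV hH.ε_pos hc hc' hpar ?_ ?_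
      · rw [hlo]
        show ε ≤ (π - H.ξ) - (-H.α (-1 - c))
        linarith [(hH.ξα (-1 - c) hc1 hc2).2]
      · rw [hup]
        show (π - H.β k) - (-H.α (-1 - c)) ≤ π - ε
        linarith [(hH.βα k (-1 - c) hc1 hc2).1]
    · rcases hYc with ⟨h1', -⟩ | ⟨-, s, hs, hpar, hlev, t, ht, hlt⟩
      · exact absurd h1' h1
      · exact ⟨s, hs, hpar, hlev, t, ht, hlt⟩
  · exact hempty (Set.eq_empty_of_forall_notMem fun v hv => by
      rcases hv n₀ ((hJmem n₀).2 hn₀) with ⟨h, -⟩ | ⟨h, -⟩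
      · exact h1 h
      · exact h2 h)

/-- **The product bound** (the hypothesis of the growth lemma, GM14 Lemma 6.7, for the
designated detour events: "a family of independent Bernoulli random variables with common
parameter `η`"): for the process started from any fixed `(ω^0, γ^0)` and every finite set `T`
of pairs `(k, n)`, the probability that all the events `Y^k_n`, `(k, n) ∈ T`, occur is at most
`η^{#T}`. [cite: GrimmettManolescu2014Isoradial, §6.2 Lemma 6.6] -/
theorem measure_forall_Yfin_le {ε : ℝ} (hH : H.Valid ε) (x₀ : ExchangeData.WState) (T : Finset (ℕ × ℤ)) :
    (Measure.pi fun _ : Fin H.K => H.piNoise) {V | ∀ i ∈ T, H.Yfin x₀ V i.1 i.2 = true} ≤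
      ENNReal.ofReal (rateBound ε) ^ T.card := by
  classical
  by_cases hT : ∀ i ∈ T, i.1 < H.K
  swap
  · push Not at hT
    obtain ⟨i, hi, hiK⟩ := hT
    have : {V : Fin H.K → H.BNoise | ∀ i ∈ T, H.Yfin x₀ V i.1 i.2 = true} = ∅ :=
      Set.eq_empty_of_forall_notMem fun V hV => by
        have := hV i hi
        simp [Yfin, not_lt.2 hiK] at this
    rw [this]; simp
  set F : Fin H.K → ExchangeData.WState → H.BNoise → ExchangeData.WState := fun k => H.blockStep k with hF
  set B : Fin H.K → Set (ExchangeData.WState × H.BNoise) :=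
    fun k => {p | ∀ n : ℤ, ((k : ℕ), n) ∈ T → H.Ycond k p.1 p.2 n} with hB
  have hBm : ∀ k, MeasurableSet (B k) := by
    intro k
    have : B k = ⋂ n : ℤ, {p | ((k : ℕ), n) ∈ T → H.Ycond k p.1 p.2 n} := by ext p; simp [hB]
    rw [this]
    refine MeasurableSet.iInter fun n => ?_
    by_cases hn : ((k : ℕ), n) ∈ T
    · have : {p : ExchangeData.WState × H.BNoise | ((k : ℕ), n) ∈ T → H.Ycond k p.1 p.2 n} =
          {p | H.Ycond k p.1 p.2 n} := by ext p; simp [hn]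
      rw [this]; exact H.measurableSet_Ycond k n
    · have : {p : ExchangeData.WState × H.BNoise | ((k : ℕ), n) ∈ T → H.Ycond k p.1 p.2 n} = Set.univ := by
        ext p; simp [hn]
      rw [this]; exact MeasurableSet.univ
  -- the event is contained in the chain event
  have hsub : {V : Fin H.K → H.BNoise | ∀ i ∈ T, H.Yfin x₀ V i.1 i.2 = true} ⊆
      {V | ∀ k : Fin H.K, (RandomMapChain.before H.K F x₀ V k, V k) ∈ B k} := by
    intro V hV k n hn
    have h1 := hV _ hn
    simp only [Yfin, k.2, if_true] at h1
    rw [H.Yb_extK_eq_true_iff x₀ V k n] at h1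
    rwa [hF, H.before_eq_traj x₀ V k]
  refine (measure_mono hsub).trans ?_
  -- the chain bound, started from the Dirac mass at `x₀`
  have hmain := RandomMapChain.measure_forall_before_mem_le H.piNoise H.K F (fun k => H.measurable_blockStep k) B hBm
    (fun k => ENNReal.ofReal (rateBound ε) ^ (T.filter fun i => i.1 = (k : ℕ)).card)
    (fun k x => piNoise_section_Ycond_le hH T k x) (Measure.dirac x₀)
  rw [Measure.dirac_prod, Measure.map_apply measurable_prodMk_left
    (RandomMapChain.measurableSet_forall_before_mem H.K F (fun k => H.measurable_blockStep k) B hBm)] at hmain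
  refine hmain.trans (le_of_eq ?_)
  rw [Finset.prod_pow_eq_pow_sum, Fin.sum_univ_eq_sum_range (fun b => (T.filter fun i => i.1 = b).card),
    ← Finset.card_eq_sum_card_fiberwise fun i hi => Finset.mem_range.2 (hT i hi)]

end HData

end TrackExchange

end Literature.Probability.Percolation
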